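/- Copyright: the b2b-balaban cell (near-miss cell 7), T⁴-continuum fan-out, NE7b swarm leaf 04 (gen 6; road W-RP, sub-row
«W3m» file 2 of 2: coordinate-level `loc`∕`sym` suppliers for the tower law at the cuts `(i, k)`).  Released under the
licence of the surrounding project. -/
import Summits.QuantumFields.BalabanUV.T4Continuum.Support.HistoryRPTowerCuts

/-!
# History chessboard road: reading the tower's coordinates at a cut `(i, k)` — `loc` and `sym` at the coordinate level (W3m, file 2)

Summits-side support leaf of the T⁴-continuum cell (rung (B)+1 on a FINITE torus only; NOT infinite volume, NOT the
mass gap, NOT the Clay statement; NOT a proof of the spine estimate NE7b).  Road W-RP (R-OWNER-23-2 ∕ R-OWNER-23-8) of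
the swarm claim table `t4/b2b-balaban-t4-ne7b-p1/LEAVES-NE7b.md`, sub-row «W3m» (journal INTENT of leaf-04 g6; scope
decision l.16331), file 2 of 2, on top of file 1 (`HistoryRPTowerCuts`: `cutVec`, `cutPos`, `cutRefl`, `towerTranslate`).
[folklore] bookkeeping; DATA def `cutBond`; no `structure`, no `[cite:]` tag, no `Prop`-valued definition (c1), no
constant (c2∕c6), no exit ∕ socket ∕ `HistoryConstants` file (c3); nothing printed asserted.

WHY.  File 1 supplies W4b′'s five RP fields for the tower law at every block hyperplane `(i, k)`.  The two remaining
structural fields of `CutoffReading` concern the EVENTS: `loc` (events of a positive-half cell are `mP i k`-measurable)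
and `sym` (`θ i k ⁻¹' E l c = E l (cellReflect i k c)`).  Which events model Bałaban's terms is the (EXT) reading and is
the instantiating seat's; what this file gives is GENERIC and coordinate-level, so that seat can assemble `loc`∕`sym` for
its events: (1) how to DESCEND the tower through `cutPos`∕`cutRefl` (the prefix `Prod.fst` and the top field `Prod.snd`,
with the cut vector scaled by `L` one level down), (2) which COORDINATES `U ↦ U b` of a level are measurable for the
transported positive algebra (exactly the bonds `b` with `b − k·e_i` positive, i.e. whose endpoints' `i`-labels lie in
`[k, k + N∕2)` — W3e's `halfPlus` band), (3) how `cutRefl` ACTS ON COORDINATES (through the cut-reflected bond `cutBond`,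
inverted on `i`-bonds).

WHAT.
* §1 `scale_cutVec` (`Site.scale (k·e_i) = (L·k)·e_i`), `cutPos_zero`, `cutRefl_zero`, `cutRefl_succ_fst`,
  `cutRefl_succ_snd` — the recursions of file 1 read one level at a time.
* §2 DESCENT: `measurable_fst_cutPos` (`Prod.fst : Tower (k+1) → Tower k` is measurable from `cutPos (k+1) i κ` to
  `cutPos k i (L·κ)`), `measurable_snd_cutPos` (the top field is measurable from `cutPos (k+1) i κ` to
  `(mPos G (k+1) i).comap (translate (κ·e_i))`).
* §3 COORDINATES: `measurable_coord_of_translate_mem_posBonds` — `U ↦ U b` is `(mPos G j i).comap (translate v)`-measurable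
  when `b.translate (−v) ∈ posBonds P j i`; `cutBond`, `translate_creflect_translate_apply` — the conjugated reflection
  `τ_{−v} ∘ c_i ∘ τ_v` reads the coordinate `b` at `cutBond i v b` (inverted on `i`-bonds), `cutBond_cutBond`.

HONEST SCOPE.  Coordinate-level suppliers; the CELL geometry of W3e (`halfPlus N i k` cells ↔ the bonds of every level
under a top cell; `cellReflect i k` on top cells ↔ `cutBond` on the bonds under them) is NOT done here — it belongs with the
(EXT) event model; (U1)∕(G2) displayed; the typing identification «`blockAvg ℰ` is Bałaban's (0.4)» T-class.  NE7b NOT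
proved; spine 0∕9.  HONEST DEPENDENCY (cell): continuum YM on T⁴ ⇐ BetaPertH ∧ nine spine estimates (0/9 proved); BetaPertH
⇐ (D1) ∧ (D4) ∧ CAP+tail; G-an2-4 gates asym, D1 and NE2/3/4.  This file changes none of it. -/

open MeasureTheory
open Literature.MathematicalPhysics.QuantumFieldTheory
open Literature.MathematicalPhysics.QuantumFieldTheory.Balaban1983to89
open T4UndoubledRP
open Summit.QuantumFields.BalabanUV.T4Continuum.HistoryRPHalfTorus
open Summit.QuantumFields.BalabanUV.T4Continuum.HistoryRPTowerLaw
open Summit.QuantumFields.BalabanUV.T4Continuum.HistoryRPTowerCuts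

namespace Summit.QuantumFields.BalabanUV.T4Continuum.HistoryRPTowerCells

noncomputable section

variable {P : Params} {G : Type*}

/-! ## §1 The recursions of file 1, one level at a time -/

section Recursions

/-- **THE CUT VECTOR SCALES BY `L` ONE LEVEL DOWN**: `Site.scale (κ·e_i) = (L·κ)·e_i` (`Site.scale_apply`, `map_zero`).
[folklore] -/
theorem scale_cutVec (k : ℕ) (i : Fin P.d) (κ : ZMod (P.sitesPerDir (k + 1))) :
    Site.scale (cutVec (k + 1) i κ) = cutVec (P := P) k i (Site.scaleCoord P k κ) := by
  funext μ
  rw [Site.scale_apply]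
  by_cases h : μ = i
  · subst h; simp [cutVec]
  · simp [cutVec, h]

/-- at height `0` the cut's positive algebra is the transported `mPos`. [folklore] -/
theorem cutPos_zero [MeasurableSpace G] (i : Fin P.d) (κ : ZMod (P.sitesPerDir 0)) :
    cutPos G 0 i κ = (mPos G 0 i).comap (GaugeField.translate (P := P) (cutVec 0 i κ)) := rfl

variable [GaugeGroup G]

/-- at height `0` the cut reflection is the conjugated centre reflection of the one field. [folklore] -/
theorem cutRefl_zero (i : Fin P.d) (κ : ZMod (P.sitesPerDir 0)) (U : Tower P G 0) :
    cutRefl 0 i κ U = ((GaugeField.translate (cutVec 0 i κ) U).creflect i).translate (-cutVec 0 i κ) := rfl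

/-- **DESCENDING THE REFLECTION, prefix**: the prefix of `cutRefl (k+1) i κ ω` is `cutRefl k i (L·κ) ω.1`. [folklore] -/
theorem cutRefl_succ_fst (k : ℕ) (i : Fin P.d) (κ : ZMod (P.sitesPerDir (k + 1))) (ω : Tower P G (k + 1)) :
    (cutRefl (k + 1) i κ ω).1 = cutRefl k i (Site.scaleCoord P k κ) ω.1 := by
  show towerTranslate k (Site.scale (-cutVec (k + 1) i κ))
      (towerRefl i k (towerTranslate k (Site.scale (cutVec (k + 1) i κ)) ω.1)) = _
  rw [map_neg, scale_cutVec]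
  rfl

/-- **DESCENDING THE REFLECTION, top field**: the top field of `cutRefl (k+1) i κ ω` is the conjugated centre reflection
of the top field. [folklore] -/
theorem cutRefl_succ_snd (k : ℕ) (i : Fin P.d) (κ : ZMod (P.sitesPerDir (k + 1))) (ω : Tower P G (k + 1)) :
    (cutRefl (k + 1) i κ ω).2 =
      ((GaugeField.translate (cutVec (k + 1) i κ) ω.2).creflect i).translate (-cutVec (k + 1) i κ) := rfl

end Recursions

/-! ## §2 Descent: the prefix and the top field are measurable for the cut's positive algebras -/

section Descent

variable [MeasurableSpace G]

/-- **DESCENDING THE POSITIVE ALGEBRA, prefix**: `Prod.fst : Tower (k+1) → Tower k` is measurable from `cutPos (k+1) i κ`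
to `cutPos k i (L·κ)`. [folklore] -/
theorem measurable_fst_cutPos (k : ℕ) (i : Fin P.d) (κ : ZMod (P.sitesPerDir (k + 1))) :
    @Measurable _ _ (cutPos G (k + 1) i κ) (cutPos G k i (Site.scaleCoord P k κ))
      (Prod.fst : Tower P G (k + 1) → Tower P G k) := by
  refine measurable_comap_iff.2 ?_
  show @Measurable _ _ (cutPos G (k + 1) i κ) (towerPos G i k)
    fun ω : Tower P G (k + 1) => towerTranslate k (cutVec k i (Site.scaleCoord P k κ)) ω.1
  have e' : (fun ω : Tower P G (k + 1) => towerTranslate k (cutVec k i (Site.scaleCoord P k κ)) ω.1) =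
      fun ω : Tower P G (k + 1) => (towerTranslate (G := G) (k + 1) (cutVec (k + 1) i κ) ω).1 := by
    funext ω
    show _ = towerTranslate k (Site.scale (cutVec (k + 1) i κ)) ω.1
    rw [scale_cutVec]
  rw [e']
  exact (@measurable_fst _ _ (towerPos G i k) (mPos G (k + 1) i)).comp
    (comap_measurable (m := (towerPos G i k).prod (mPos G (k + 1) i))
      (towerTranslate (G := G) (k + 1) (cutVec (k + 1) i κ)))

/-- **DESCENDING THE POSITIVE ALGEBRA, top field**: `Prod.snd : Tower (k+1) → GaugeField P (k+1) G` is measurable from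
`cutPos (k+1) i κ` to `(mPos G (k+1) i).comap (translate (κ·e_i))`. [folklore] -/
theorem measurable_snd_cutPos (k : ℕ) (i : Fin P.d) (κ : ZMod (P.sitesPerDir (k + 1))) :
    @Measurable _ _ (cutPos G (k + 1) i κ)
      ((mPos G (k + 1) i).comap (GaugeField.translate (cutVec (k + 1) i κ)))
      (Prod.snd : Tower P G (k + 1) → GaugeField P (k + 1) G) := by
  refine measurable_comap_iff.2 ?_
  have hΦ := comap_measurable (m := (towerPos G i k).prod (mPos G (k + 1) i))
    (towerTranslate (G := G) (k + 1) (cutVec (k + 1) i κ))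
  exact (@measurable_snd _ _ (towerPos G i k) (mPos G (k + 1) i)).comp hΦ

end Descent

/-! ## §3 Coordinates: which bond variables are positive-readable, and how the cut reflection reads them -/

section Coordinates

/-- `b.translate 0 = b`. [folklore] -/
theorem pbond_translate_zero {j : ℕ} (b : PBond P j) : b.translate (0 : Site P j) = b := by
  cases b; simp [PBond.translate]

/-- **`loc` AT THE COORDINATE LEVEL**: the coordinate `U ↦ U b` is measurable for the transported positive algebra
`(mPos G j i).comap (translate v)` whenever the bond translated back, `b.translate (−v)`, is positive — for
`v = κ·e_i`: both endpoints' `i`-labels in the band `[κ, κ + N_j∕2)` (the links INSIDE W3e's `halfPlus` slab). [folklore] -/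
theorem measurable_coord_of_translate_mem_posBonds [MeasurableSpace G] {j : ℕ} (i : Fin P.d) (v : Site P j)
    (b : PBond P j)
    (hb : b.translate (-v) ∈ posBonds P j i) :
    @Measurable _ _ ((mPos G j i).comap (GaugeField.translate (G := G) v)) _ fun U : GaugeField P j G => U b := by
  have hread : (fun U : GaugeField P j G => U b) =
      (fun W : GaugeField P j G => W (b.translate (-v))) ∘ GaugeField.translate v := by
    funext U
    simp only [Function.comp_apply, GaugeField.translate_apply, PBond.translate_translate, neg_add_cancel,
      pbond_translate_zero]
  rw [hread]
  refine Measurable.comp ?_ (comap_measurable _)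
  have hres := measurable_restrict_mPos G j i (P := P)
  exact (measurable_pi_apply (⟨b.translate (-v), hb⟩ : ↥(posBonds P j i))).comp hres

/-- **THE CUT-REFLECTED BOND**: the bond at which the conjugated reflection `τ_{−v} ∘ c_i ∘ τ_v` reads the coordinate
`b` — `c_i` applied to `b − v`, translated back by `v`. -/
def cutBond {j : ℕ} (i : Fin P.d) (v : Site P j) (b : PBond P j) : PBond P j := (cbond i (b.translate (-v))).translate v

/-- direction of `cutBond`. [folklore] -/
@[simp] theorem cutBond_dir {j : ℕ} (i : Fin P.d) (v : Site P j) (b : PBond P j) : (cutBond i v b).dir = b.dir := rfl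

/-- `cutBond` is an involution (`cbond_cbond`). [folklore] -/
theorem cutBond_cutBond {j : ℕ} (i : Fin P.d) (v : Site P j) (b : PBond P j) : cutBond i v (cutBond i v b) = b := by
  simp only [cutBond, PBond.translate_translate, add_neg_cancel, pbond_translate_zero, cbond_cbond, neg_add_cancel]

/-- **`sym` AT THE COORDINATE LEVEL**: the conjugated centre reflection reads the coordinate `b` at `cutBond i v b`,
inverted on `i`-bonds: `(τ_{−v} (c_i (τ_v U))) b = U (cutBond i v b)^{∓1}`. [folklore] -/
theorem translate_creflect_translate_apply [GaugeGroup G] {j : ℕ} (i : Fin P.d) (v : Site P j) (U : GaugeField P j G)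
    (b : PBond P j) :
    ((GaugeField.translate v U).creflect i).translate (-v) b =
      if b.dir = i then (U (cutBond i v b))⁻¹ else U (cutBond i v b) := by
  rw [GaugeField.translate_apply, creflect_apply]
  rfl

/-- … in particular for the top field of the tower under `cutRefl (k+1) i κ` (`cutRefl_succ_snd`). [folklore] -/
theorem cutRefl_succ_snd_apply [GaugeGroup G] (k : ℕ) (i : Fin P.d) (κ : ZMod (P.sitesPerDir (k + 1)))
    (ω : Tower P G (k + 1))
    (b : PBond P (k + 1)) :
    (cutRefl (k + 1) i κ ω).2 b =
      if b.dir = i then (ω.2 (cutBond i (cutVec (k + 1) i κ) b))⁻¹ else ω.2 (cutBond i (cutVec (k + 1) i κ) b) := by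
  rw [cutRefl_succ_snd, translate_creflect_translate_apply]

/-- … and for the one field at height `0`. [folklore] -/
theorem cutRefl_zero_apply [GaugeGroup G] (i : Fin P.d) (κ : ZMod (P.sitesPerDir 0)) (U : Tower P G 0) (b : PBond P 0) :
    cutRefl 0 i κ U b = if b.dir = i then (U (cutBond i (cutVec 0 i κ) b))⁻¹ else U (cutBond i (cutVec 0 i κ) b) := by
  rw [cutRefl_zero, translate_creflect_translate_apply]

end Coordinates

/-! ## §4 Sanity: a top-field coordinate of a height-`1` tower, positive for the cut, is `cutPos`-measurable -/

section Sanity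

variable [MeasurableSpace G]

/-- USE PATTERN for the instantiating seat: at height `k+1`, a top-level bond `b` with `b − κ·e_i` positive gives a
`cutPos (k+1) i κ`-measurable coordinate `ω ↦ ω.2 b` (descent `measurable_snd_cutPos` + coordinate lemma). [folklore] -/
example (k : ℕ) (i : Fin P.d) (κ : ZMod (P.sitesPerDir (k + 1))) (b : PBond P (k + 1))
    (hb : b.translate (-cutVec (k + 1) i κ) ∈ posBonds P (k + 1) i) :
    @Measurable _ _ (cutPos G (k + 1) i κ) _ fun ω : Tower P G (k + 1) => ω.2 b :=
  (measurable_coord_of_translate_mem_posBonds (G := G) i (cutVec (k + 1) i κ) b hb).comp (measurable_snd_cutPos k i κ)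

/-- … and one level down: a level-`k` coordinate of the prefix (prefix descent `measurable_fst_cutPos`, then the height-`k`
reading at the scaled cut `L·κ`). [folklore] -/
example (k : ℕ) (i : Fin P.d) (κ : ZMod (P.sitesPerDir (k + 1 + 1))) (b : PBond P (k + 1))
    (hb : b.translate (-cutVec (k + 1) i (Site.scaleCoord P (k + 1) κ)) ∈ posBonds P (k + 1) i) :
    @Measurable _ _ (cutPos G (k + 1 + 1) i κ) _ fun ω : Tower P G (k + 1 + 1) => ω.1.2 b :=
  ((measurable_coord_of_translate_mem_posBonds (G := G) i _ b hb).comp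
    (measurable_snd_cutPos k i (Site.scaleCoord P (k + 1) κ))).comp (measurable_fst_cutPos (k + 1) i κ)

end Sanity

end

end Summit.QuantumFields.BalabanUV.T4Continuum.HistoryRPTowerCells
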